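import Literature.NumberTheory.Transcendental.RoySmallValueEstimatesNotInProofs
import HarnessLib

/-!
# Small value estimates at rational translates (Nguyen–Roy 2016) — proofs, XIX: the instantiation of the endgame

Nineteenth proofs file towards `Literature.NumberTheory.Transcendental.nguyenRoy2016_thm_1` (Nguyen–Roy,
IJNT 12 (2016) = arXiv:1412.5163). Everything here is PROVED; no named facts. The hypothesis
structure `NguyenRoy.EndgameData σ β ν` of file VIII (whose `false_of_constraints` is the whole
of §5 Prop. 17 – §6 of the paper) is instantiated by the concrete objects of files XIII–XVIII:
points `ℙ²(ℂ)` with the projective distance `pdist`, the translations `tauQ r hs i`, the points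
`γ_i = gamP`, the algebraic points `AlgPt` as zero-dimensional `ℚ`-subvarieties (`pts = conj`,
`ht = deg · h_abs`), `τV = tauA`, Lemma 5 (`pdist_tauP_le`), Lemma 11 (`ht_tauA_le`),
Proposition 12 (`liouville_conj`), positivity (`pdist_pos_of_mem_conj_gamP`), `W_D` (`IsIn`,
`isIn_of_mem`) and the estimate for `Z ⊄ W_D` (`notIn`, from Proposition 4's `P̃_D`).

What is NOT constructed here is the content of **Propositions 14, 15 and Corollary 16** (the
subvarieties `Z_D ⊆ W_D` with the small-value estimate `∑ (D^β + log dist(α, γ_{ι α})) ≤ −κ …`, and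
the degree/height bounds for the translates of subvarieties of `W_D`), i.e. the part of the paper
resting on Roy 2013, Thm. 5.6 and Props. 6.1, 6.2, 2.3: it enters as the explicit hypothesis
structure `WallData` below, stated in the concrete terms of files XVI–XVIII. Consequently

* `endgameData` — the `EndgameData σ β ν` built from the concrete objects and a `WallData`;
* **`false_of_wallData`** — under the hypotheses of Theorem 1 on `σ, β, ν`, with `(ξ, η) ∉ ℚ̄ × ℚ̄`,
  the data of Proposition 4 from `D₀` on and a `WallData`, `False`.

So `nguyenRoy2016_thm_1` is reduced to producing, for `(ξ, η) ∉ ℚ̄ × ℚ̄` and the `P̃_D` of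
`NguyenRoy.prop4`, an inhabitant of `WallData` (Propositions 14–16).

## References

* [NguyenRoy2016] N. A. V. Nguyen, D. Roy, IJNT 12 (2016) 1273–1293 = arXiv:1412.5163, §§2, 4, 5, 6.
-/

noncomputable section

open Height Module Finset MvPolynomial Filter
open Literature.NumberTheory.Transcendental.Nesterenko
open scoped Classical

namespace Literature.NumberTheory.Transcendental

namespace NguyenRoy

section wall

variable (ξ η : ℂ) (r s : ℚ) (hs : s ≠ 0) (σ β ν : ℝ) (Pt : ℕ → MvPolynomial (Fin 3) ℤ) (D₀ : ℕ)

/-- **The wall**: Propositions 14, 15 and Corollary 16 of Nguyen–Roy 2016 for the data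
`(ξ, η, r, s, σ, β, ν)` and the polynomials `P̃_D = Pt D` (`D ≥ D₀`), in the concrete terms of the
instantiation (`V = AlgPt`, `pts = conj`, `ht = deg · h_abs`, `dist = pdist`, `γ_i = gamP`,
`Z ⊆ W_D ↔ IsIn`). Nothing is asserted: this is a bundle of hypotheses.
[cite: NguyenRoy2016, Proposition 14, Proposition 15, Corollary 16] -/
structure WallData : Type where
  /-- Proposition 14: constants. -/
  A₁₄ : ℝ
  B₁₄ : ℝ
  one_le_A₁₄ : 1 ≤ A₁₄
  one_le_B₁₄ : 1 ≤ B₁₄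
  /-- Proposition 14: `Z ⊆ W_D`, `|i| < 3⌊D^σ⌋` ⟹ `deg(τⁱZ) ≤ A D^{2−σ}`, `h(τⁱZ) ≤ B D^{1+β−σ}`. -/
  prop14 : ∀ D : ℕ, D₀ ≤ D → ∀ Z : AlgPt, IsIn r s σ Pt Z D → ∀ i : ℤ,
    |(i : ℝ)| < 3 * ⌊(D : ℝ) ^ σ⌋₊ →
      (((Z.tauA r hs i).conj).card : ℝ) ≤ A₁₄ * (D : ℝ) ^ (2 - σ) ∧
        (Z.tauA r hs i).ht ≤ B₁₄ * (D : ℝ) ^ (1 + β - σ)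
  /-- Proposition 15: the subvarieties `Z_D ⊆ W_D` (recorded by a point). -/
  Z : ℕ → AlgPt
  isIn_Z : ∀ D : ℕ, D₀ ≤ D → IsIn r s σ Pt (Z D) D
  /-- Corollary 16. -/
  κ : ℝ
  κ_pos : 0 < κ
  cor16 : ∀ D : ℕ, D₀ ≤ D → ∃ ι : PPt → ℤ,
    (∀ a ∈ (Z D).conj, 0 ≤ ι a ∧ ι a < (⌊(D : ℝ) ^ σ⌋₊ : ℕ)) ∧
    ∑ a ∈ (Z D).conj, ((D : ℝ) ^ β + Real.log (pdist a (gamP ξ η (r : ℂ) (s : ℂ) (ι a)))) ≤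
      -(κ * (D : ℝ) ^ (ν - β + σ - 2) * (2 * (D : ℝ) ^ β * ((Z D).conj).card + D * (Z D).ht))

variable {ξ η r s σ β ν Pt D₀}

/-- **The concrete `EndgameData`.** [cite: NguyenRoy2016, §§2, 4, 5] -/
def endgameData (hη : η ≠ 0) (hξη : ¬ (IsAlgebraic ℚ ξ ∧ IsAlgebraic ℚ η))
    (hPt : ∀ D : ℕ, D₀ ≤ D → PropsAt ξ η r s σ β ν Pt D) (W : WallData ξ η r s hs σ β ν Pt D₀) :
    EndgameData σ β ν where
  Pt := PPt
  V := AlgPt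
  dist := pdist
  dist_nonneg := pdist_nonneg
  dist_le_two := pdist_le_two
  dist_comm := pdist_comm
  dist_triangle := pdist_triangle
  τ := tauQ r hs
  τ_zero := AlgPt.tauQ_zero r hs
  τ_τ := AlgPt.tauQ_tauQ r hs
  c₁ := Real.log (tauConst (r : ℂ) (s : ℂ))
  c₁_nonneg := Real.log_nonneg (one_le_tauConst (r : ℂ) (cast_ne_zero' hs))
  dist_τ_le := fun i a b => pdist_tauP_le (r : ℂ) (cast_ne_zero' hs) i a b
  γ := gamP ξ η (r : ℂ) (s : ℂ)
  τ_γ := fun i j => tauP_gamP ξ η (r : ℂ) (cast_ne_zero' hs) i j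
  pts := AlgPt.conj
  pts_nonempty := AlgPt.conj_nonempty
  ht := AlgPt.ht
  ht_nonneg := AlgPt.ht_nonneg
  τV := fun i Z => Z.tauA r hs i
  τV_zero := fun Z => Z.tauA_zero r hs
  τV_τV := fun i j Z => Z.tauA_tauA r hs i j
  mem_pts_τV := fun i Z b => Z.mem_conj_tauA r hs i b
  c₄ := AlgPt.c4 r s
  c₄_nonneg := AlgPt.c4_nonneg r hs
  ht_τV_le := fun i Z => by
    rw [Z.card_conj]
    exact Z.ht_tauA_le r hs i
  c₁₂ := Real.log 2
  c₁₂_nonneg := Real.log_nonneg one_le_two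
  liouville := fun Z Z' a ha a' ha' hne => by
    rw [Z.card_conj, Z'.card_conj]
    exact Z.liouville_conj Z' ha ha' hne
  dist_γ_pos := fun Z a ha i => pdist_pos_of_mem_conj_gamP ξ η r hs hη hξη Z ha i
  IsIn := IsIn r s σ Pt
  isIn_of_mem := fun D Z Z' b hb hb' h => isIn_of_mem D Z Z' b hb hb' h
  D₀ := D₀
  A₁₄ := W.A₁₄
  B₁₄ := W.B₁₄
  one_le_A₁₄ := W.one_le_A₁₄
  one_le_B₁₄ := W.one_le_B₁₄
  prop14 := W.prop14
  Z := W.Z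
  isIn_Z := W.isIn_Z
  κ := W.κ
  κ_pos := W.κ_pos
  cor16 := W.cor16
  c₇ := 0
  c₇_nonneg := le_rfl
  notIn := fun D hD Zv hnot => notIn hs (hPt D hD) Zv hnot

/-- **Theorem 1 modulo the wall.** Under the hypotheses of Theorem 1 on `σ, β, ν`, if
`(ξ, η) ∉ ℚ̄ × ℚ̄`, the homogenised polynomials of Proposition 4 are available from `D₀` on, and
Propositions 14–16 hold for them (`WallData`), we reach a contradiction (§6).
[cite: NguyenRoy2016, Theorem 1 (proof, §6)] -/
theorem false_of_wallData (hη : η ≠ 0) (hξη : ¬ (IsAlgebraic ℚ ξ ∧ IsAlgebraic ℚ η))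
    (hσ1 : 1 ≤ σ) (hσ2 : σ < 2) (hβ : σ + 1 < β) (hν1 : 3 / 2 ≤ σ → 2 + β - σ < ν)
    (hν2 : σ < 3 / 2 → 2 + β - σ + (σ - 1) * (3 - 2 * σ) / (2 + β - 2 * σ) < ν)
    (hPt : ∀ D : ℕ, D₀ ≤ D → PropsAt ξ η r s σ β ν Pt D) (W : WallData ξ η r s hs σ β ν Pt D₀) :
    False :=
  (endgameData hs hη hξη hPt W).false_of_constraints hσ1 hσ2 hβ hν1 hν2

end wall

/-! ### The data of Proposition 4 as a sequence -/

/-- From the `∀ᶠ` statement of Proposition 4 to a sequence `P̃_D` with its properties (`PropsAt`,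
and the support witnesses `SuppAt`) from some `D₀` on. [cite: NguyenRoy2016, Proposition 4] -/
theorem exists_Pt_of_prop4 {ξ η : ℂ} (hη : η ≠ 0) {r s : ℚ} (hs : s ≠ 0) {σ β ν : ℝ}
    (hσ1 : 1 ≤ σ) (hβ : σ + 1 < β) (hν : σ + 1 < ν)
    (hP : ∀ᶠ D : ℕ in atTop, ∃ P : MvPolynomial (Fin 2) ℤ, P ≠ 0 ∧ P.totalDegree ≤ D ∧
      (mvPolyHeight P : ℝ) ≤ Real.exp ((D : ℝ) ^ β) ∧
      ∀ i : ℕ, i < 4 * ⌊(D : ℝ) ^ σ⌋₊ →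
        ‖aeval ![ξ + (i : ℂ) * (r : ℂ), η * (s : ℂ) ^ i] P‖ ≤ Real.exp (-(D : ℝ) ^ ν)) :
    ∃ (Pt : ℕ → MvPolynomial (Fin 3) ℤ) (D₀ : ℕ), (∀ D : ℕ, D₀ ≤ D → PropsAt ξ η r s σ β ν Pt D) ∧
      (∀ D : ℕ, D₀ ≤ D → SuppAt Pt D) := by
  have h4 := prop4 hη hs hσ1 hβ hν hP
  rw [Filter.eventually_atTop] at h4
  obtain ⟨D₀, hD₀⟩ := h4
  choose! Pt hPt using hD₀
  refine ⟨Pt, D₀, fun D hD => ?_, fun D hD => ?_⟩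
  · obtain ⟨hhom, hne, -, -, hall⟩ := hPt D hD
    exact ⟨hhom, hne, fun i hi => hall i hi⟩
  · obtain ⟨-, -, h0, h2, -⟩ := hPt D hD
    exact ⟨h0, h2⟩

/-- **Theorem 1 for one set of data, reduced to the wall for that data.** For fixed
`(ξ, η, r, s, σ, β, ν)` satisfying the hypotheses of Theorem 1: if for every sequence `P̃_D` with
the properties of Proposition 4 (`PropsAt`, `SuppAt` from some `D₀` on) — and assuming
`(ξ, η) ∉ ℚ̄ × ℚ̄` — one can produce a `WallData` from some later level on, then the conclusion of
Theorem 1 holds for these data. [cite: NguyenRoy2016, Theorem 1 (structure of the proof)] -/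
theorem thm1_pointwise_of_wall {ξ η : ℂ} (hη : η ≠ 0) {r s : ℚ} (hs : s ≠ 0)
    {σ β ν : ℝ} (hσ1 : 1 ≤ σ) (hσ2 : σ < 2) (hβ : σ + 1 < β)
    (hν1 : 3 / 2 ≤ σ → 2 + β - σ < ν)
    (hν2 : σ < 3 / 2 → 2 + β - σ + (σ - 1) * (3 - 2 * σ) / (2 + β - 2 * σ) < ν)
    (wall : ¬ (IsAlgebraic ℚ ξ ∧ IsAlgebraic ℚ η) → 2 + β - σ < ν →
      ∀ (Pt : ℕ → MvPolynomial (Fin 3) ℤ) (D₀ : ℕ),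
        (∀ D : ℕ, D₀ ≤ D → PropsAt ξ η r s σ β ν Pt D) → (∀ D : ℕ, D₀ ≤ D → SuppAt Pt D) →
        ∃ D₁ : ℕ, D₀ ≤ D₁ ∧ Nonempty (WallData ξ η r s hs σ β ν Pt D₁))
    (hP : ∀ᶠ D : ℕ in atTop, ∃ P : MvPolynomial (Fin 2) ℤ, P ≠ 0 ∧ P.totalDegree ≤ D ∧
      (mvPolyHeight P : ℝ) ≤ Real.exp ((D : ℝ) ^ β) ∧
      ∀ i : ℕ, i < 4 * ⌊(D : ℝ) ^ σ⌋₊ →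
        ‖aeval ![ξ + (i : ℂ) * (r : ℂ), η * (s : ℂ) ^ i] P‖ ≤ Real.exp (-(D : ℝ) ^ ν)) :
    IsAlgebraic ℚ ξ ∧ IsAlgebraic ℚ η := by
  by_contra hξη
  have hν' : 2 + β - σ < ν := by
    rcases le_or_gt (3 / 2 : ℝ) σ with h | h
    · exact hν1 h
    · have h2 := hν2 h
      have hpos : 0 ≤ (σ - 1) * (3 - 2 * σ) / (2 + β - 2 * σ) :=
        div_nonneg (mul_nonneg (by linarith) (by linarith)) (by linarith)
      linarith
  have hν : σ + 1 < ν := by linarith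
  obtain ⟨Pt, D₀, hPt, hSupp⟩ := exists_Pt_of_prop4 hη hs hσ1 hβ hν hP
  obtain ⟨D₁, hD₁, ⟨W⟩⟩ := wall hξη hν' Pt D₀ hPt hSupp
  exact false_of_wallData hs hη hξη hσ1 hσ2 hβ hν1 hν2 (fun D hD => hPt D (hD₁.trans hD)) W

/-- **Theorem 1 reduced to the wall**: if for every `(ξ, η) ∉ ℚ̄ × ℚ̄` (with the other data of
Theorem 1, including `ν > 2 + β − σ`, the consequence of the two printed conditions on `ν` that the
proof of Proposition 15 uses) and every sequence `P̃_D` with the properties of Proposition 4 from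
some `D₀` on one can
produce a `WallData` (Propositions 14–16) from some later level on (using also `X₀ ∤ P̃_D`,
`X₂ ∤ P̃_D`, `SuppAt`), then `nguyenRoy2016_thm_1` holds.
[cite: NguyenRoy2016, Theorem 1 (structure of the proof)] -/
theorem nguyenRoy2016_thm_1_of_wall
    (wall : ∀ (ξ η : ℂ), η ≠ 0 → ¬ (IsAlgebraic ℚ ξ ∧ IsAlgebraic ℚ η) →
      ∀ (r s : ℚ) (hs : s ≠ 0), r ≠ 0 → s ≠ 1 → s ≠ -1 → ∀ (σ β ν : ℝ), 1 ≤ σ → σ < 2 → σ + 1 < β →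
      2 + β - σ < ν →
      ∀ (Pt : ℕ → MvPolynomial (Fin 3) ℤ) (D₀ : ℕ),
        (∀ D : ℕ, D₀ ≤ D → PropsAt ξ η r s σ β ν Pt D) → (∀ D : ℕ, D₀ ≤ D → SuppAt Pt D) →
        ∃ D₁ : ℕ, D₀ ≤ D₁ ∧ Nonempty (WallData ξ η r s hs σ β ν Pt D₁)) :
    nguyenRoy2016_thm_1 :=
  fun _ξ _η hη r s hr hs hs1 hs2 σ β ν hσ1 hσ2 hβ hν1 hν2 hP =>
    thm1_pointwise_of_wall hη hs hσ1 hσ2 hβ hν1 hν2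
      (fun hξη hν' Pt D₀ hPt hSupp => wall _ _ hη hξη r s hs hr hs1 hs2 σ β ν hσ1 hσ2 hβ hν' Pt D₀ hPt hSupp)
      hP

end NguyenRoy

end Literature.NumberTheory.Transcendental

end
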